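import Summits.QuantumFields.GaugeBoot.OneOverNAPriori
import Summits.QuantumFields.GaugeBoot.OneOverNOrderLimit
import HarnessLib

/-!
# The `1/N` expansion to all orders, V: the remainder hierarchy — base and inductive steps (gauge-boot, ADDENDUM 30 part E)

HONEST FRAMING (cell `pub-gaugeboot`, page 1 of every file): the venture produces certified bounds
on lattice expectations at stated coupling, gauge group, dimension and torus size; NOT a mass gap,
NOT a continuum limit, NOT a string tension; NOT Yang–Mills-summit-bearing (barriers
`FixedCouplingUltralocality`, `PerturbativeInvisibility`).  Strong-coupling `SO(N)` lattice gauge theory with free boundary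
condition (S. Chatterjee, Comm. Math. Phys. **366** (2019); the `1/N` expansion: S. Chatterjee, J. Jafarov, arXiv:1604.04777);
nothing about four-dimensional continuum Yang–Mills or a mass gap.

## Content

THE REMAINDER HIERARCHY.  For a real `β`, functions `R_ℓ(Λ, N) : 𝒮 → ℝ` and `F_ℓ : 𝒮 → ℝ` (`ℓ ≥ 0`) with

  `R₀ = φ_{Λ,N,β}/N̂²`,  `R_{ℓ+1} = N̂ (R_ℓ − F_ℓ)`  (`N̂ = max(N,1)`),  `F_ℓ = lim_N R_ℓ([−N², N²]^d, N)` whenever the limit exists,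

so that `R₂ = φ`, `F₀ = F₁ = 0`, `F₂ = lim φ` (the 't Hooft limit), `R₃ = N(φ − F₂)`, `F₃` = the first-order correction, …,
`R_{k+2} = N^k (φ − Σ_{j<k} F_{j+2} N^{−j})`, `F_{k+2} = f_k` = the `k`-th coefficient of the `1/N` expansion.  This file proves the
three order-free facts that drive the induction of the sibling `OneOverNExpansion`:
* `hierarchy_base` — level two: `R₂ = φ`, `F₀ = F₁ = 0`, the a priori bounds `|φ|, |φ/N| ≤ Φ`, the finite-`N` master loop equation
  in hierarchy form (Theorem 3.6), the trivial limits `φ/N, φ/N² → 0`, `R₂(∅) = 1`;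
* `hierarchy_out` — from the level-`ℓ` data (a priori bound at depth `c_j(N) = 4j(log₂N+3)`, hierarchy equation, convergence of the two
  previous levels) the limit `F_ℓ`: convergence along every admissible cube sequence, `F_ℓ(∅)`, `|F_ℓ| ≤ B_jΦ_{K_j}`, and the recursive
  sourced equation `|t|F_ℓ − RHS(F_ℓ) = |t|F_{ℓ−1} + Σ_{𝕋^∓}±F_{ℓ−1} + Σ_{𝕄^∓}±F_{ℓ−2}` (Chatterjee–Jafarov (5.2)) — via `order_limit`;
* `hierarchy_succ` — the next level's a priori bounds (via `apriori_step` with `K_{j+1} ≥ 64K_j²`, `B_{j+1} ≥ 21B_j`), hierarchy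
  equation (`equation_next`) and value at `∅`.

Everything is `[folklore]` given the siblings.
-/

noncomputable section

open Filter Topology
open Literature.Probability.LatticeModels (Site box)
open Literature.MathematicalPhysics.QuantumFieldTheory (latticeNorm)
open Literature.MathematicalPhysics.QuantumFieldTheory.Chatterjee2019LargeN
open Literature.MathematicalPhysics.QuantumFieldTheory.Chatterjee2019LargeN.CoeffCatalanBoundProof

namespace Summit.QuantumFields.GaugeBoot

namespace StringDuality

variable {d : ℕ}

/-! ## Admissible sequences of cubes -/

/-- The canonical cubes `[−N², N²]^d` are admissible at every level: `4j(log₂N+3) + a ≤ N²` eventually. [folklore] -/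
theorem adm_canonical (j a : ℕ) : ∀ᶠ N : ℕ in atTop, j * (4 * (Nat.log 2 N + 3)) + a ≤ N * N := by
  filter_upwards [eventually_ge_atTop (16 * j + a + 1)] with N hN
  have h1 : Nat.log 2 N ≤ N := Nat.log_le_self 2 N
  have h2 : j * (4 * (Nat.log 2 N + 3)) ≤ j * (4 * (N + 3)) := Nat.mul_le_mul_left _ (Nat.mul_le_mul_left _ (by omega))
  nlinarith

/-- Super-logarithmic growth `a log₂N ≤ M_N` (every `a`, eventually) gives admissibility at every level. [folklore] -/
theorem adm_of_superlog {M : ℕ → ℕ} (hM : ∀ a : ℕ, ∀ᶠ N : ℕ in atTop, a * Nat.log 2 N ≤ M N) (j a : ℕ) :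
    ∀ᶠ N : ℕ in atTop, j * (4 * (Nat.log 2 N + 3)) + a ≤ M N := by
  filter_upwards [hM (16 * j + a), eventually_ge_atTop 2] with N hN hN2
  have h1 : 1 ≤ Nat.log 2 N := Nat.log_pos one_lt_two hN2
  nlinarith

/-- Admissibility at level `j + 1` implies admissibility at level `j`. [folklore] -/
theorem adm_mono {M : ℕ → ℕ} {j : ℕ} (hM : ∀ a : ℕ, ∀ᶠ N : ℕ in atTop, (j + 1) * (4 * (Nat.log 2 N + 3)) + a ≤ M N)
    (a : ℕ) : ∀ᶠ N : ℕ in atTop, j * (4 * (Nat.log 2 N + 3)) + a ≤ M N := by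
  filter_upwards [hM a] with N hN
  nlinarith

/-! ## Level two: the base of the hierarchy -/

/-- **The base of the hierarchy.**  With `R₀ = φ/N̂²`, `R₁ = N̂(R₀ − F₀)`, `R₂ = N̂(R₁ − F₁)` and `F₀, F₁` the limits along the
canonical cubes (hence `0`): `R₂ = φ`, `|R₂|, |R₁| ≤ Φ_K` (`K ≥ 1`), the hierarchy equation at level two (Theorem 3.6),
`R₁, R₀ → 0` along any cubes, and `R₂(∅) = 1`. [cite: Chatterjee2019LargeN, Theorem 3.6; ChatterjeeJafarov2016OneOverN, Lemma 5.4 (q = 0)] -/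
theorem hierarchy_base (hd : 2 ≤ d) (β : ℝ) {K B : ℝ} (hK1 : 1 ≤ K) (hB1 : 1 ≤ B)
    (R : ℕ → Finset (Site d) → ℕ → LoopSeq d → ℝ) (F : ℕ → LoopSeq d → ℝ)
    (hR0 : ∀ (Λ : Finset (Site d)) (N : ℕ) (u : LoopSeq d), R 0 Λ N u = phi N β Λ u / ((max N 1 : ℕ) : ℝ) ^ 2)
    (hrec : ∀ (ℓ : ℕ) (Λ : Finset (Site d)) (N : ℕ) (u : LoopSeq d),
      R (ℓ + 1) Λ N u = ((max N 1 : ℕ) : ℝ) * (R ℓ Λ N u - F ℓ u))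
    (hF : ∀ (ℓ : ℕ) (t : LoopSeq d), (∃ q : ℝ, Tendsto (fun N : ℕ => R ℓ (box d (N * N)) N t) atTop (𝓝 q)) →
      Tendsto (fun N : ℕ => R ℓ (box d (N * N)) N t) atTop (𝓝 (F ℓ t))) :
    (∀ (Λ : Finset (Site d)) (N : ℕ) (u : LoopSeq d), R 2 Λ N u = phi N β Λ u) ∧
    (∀ u : LoopSeq d, F 0 u = 0) ∧ (∀ u : LoopSeq d, F 1 u = 0) ∧
    (∀ (Λ : Finset (Site d)) (N : ℕ), 2 ≤ N → ∀ t : LoopSeq d, IsLoopSeq t → |R 2 Λ N t| ≤ B * (K ^ t.index * catProd t)) ∧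
    (∀ (Λ : Finset (Site d)) (N : ℕ), 2 ≤ N → ∀ t : LoopSeq d, IsLoopSeq t → |R 1 Λ N t| ≤ B * (K ^ t.index * catProd t)) ∧
    (∀ Λ : Finset (Site d), Λ.Nonempty → ∀ N : ℕ, 2 ≤ N → ∀ t : LoopSeq d, IsLoopSeq t → t ≠ [] →
      (∀ l ∈ t, ∀ e ∈ l, ∀ v : Site d,
        latticeNorm (v - DEdge.src e) ≤ 1 ∨ latticeNorm (v - DEdge.tgt e) ≤ 1 → v ∈ Λ) →
      (t.len : ℝ) * R 2 Λ N t -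
          ((∑ o : InvIdx t, R 2 Λ N (t.negSplitAt o)) - (∑ o : SameIdx t, R 2 Λ N (t.posSplitAt o))
            + β * (∑ o : DeformIdx t, R 2 Λ N (t.negDeformAt o)) - β * (∑ o : DeformIdx t, R 2 Λ N (t.posDeformAt o))) =
        (t.len : ℝ) * R 1 Λ N t
          + ((∑ o : SameIdx t, R 1 Λ N (t.negTwistAt o)) - ∑ o : InvIdx t, R 1 Λ N (t.posTwistAt o))
          + ((∑ o : MergeIdx t, R 0 Λ N (t.negMergeAt o)) - ∑ o : MergeIdx t, R 0 Λ N (t.posMergeAt o))) ∧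
    (∀ (M : ℕ → ℕ) (t : LoopSeq d), Tendsto (fun N : ℕ => R 1 (box d (M N)) N t) atTop (𝓝 (F 1 t))) ∧
    (∀ (M : ℕ → ℕ) (t : LoopSeq d), Tendsto (fun N : ℕ => R 0 (box d (M N)) N t) atTop (𝓝 (F 0 t))) ∧
    (∀ (Λ : Finset (Site d)) (N : ℕ), R 2 Λ N [] = 1) := by
  have hK0 : 0 ≤ K := by linarith
  -- `N̂ ≥ 1`, and `φ/N̂ᵖ → 0`
  have hhat : ∀ N : ℕ, (1 : ℝ) ≤ ((max N 1 : ℕ) : ℝ) := fun N => by exact_mod_cast le_max_right N 1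
  have hhat' : ∀ N : ℕ, 2 ≤ N → ((max N 1 : ℕ) : ℝ) = N := fun N hN => by rw [max_eq_left (by omega)]
  have hsmall : ∀ (p : ℕ), 1 ≤ p → ∀ (Λ : ℕ → Finset (Site d)) (u : LoopSeq d),
      Tendsto (fun N : ℕ => phi N β (Λ N) u / ((max N 1 : ℕ) : ℝ) ^ p) atTop (𝓝 0) := by
    intro p hp Λ u
    have h1 : Tendsto (fun N : ℕ => ((max N 1 : ℕ) : ℝ)) atTop atTop := by
      refine tendsto_natCast_atTop_atTop.comp ?_
      exact Filter.tendsto_atTop_atTop.mpr fun b => ⟨b, fun N hN => hN.trans (le_max_left _ _)⟩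
    have h2 : Tendsto (fun N : ℕ => (((max N 1 : ℕ) : ℝ) ^ p)⁻¹) atTop (𝓝 0) :=
      tendsto_inv_atTop_zero.comp (tendsto_pow_atTop (by omega) |>.comp h1)
    rw [Metric.tendsto_nhds] at h2 ⊢
    intro ε hε
    filter_upwards [h2 ε hε] with N hN
    rw [Real.dist_eq, sub_zero] at hN ⊢
    have hpos : (0 : ℝ) < ((max N 1 : ℕ) : ℝ) ^ p := pow_pos (lt_of_lt_of_le one_pos (hhat N)) _
    rw [abs_of_pos (inv_pos.mpr hpos)] at hN
    calc |phi N β (Λ N) u / ((max N 1 : ℕ) : ℝ) ^ p| = |phi N β (Λ N) u| * (((max N 1 : ℕ) : ℝ) ^ p)⁻¹ := by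
          rw [abs_div, abs_of_pos hpos, div_eq_mul_inv]
      _ ≤ 1 * (((max N 1 : ℕ) : ℝ) ^ p)⁻¹ :=
          mul_le_mul_of_nonneg_right (abs_phi_le_one _ _ _ _) (inv_nonneg.mpr hpos.le)
      _ < ε := by rw [one_mul]; exact hN
  -- `F₀ = 0`, `R₁ = φ/N̂`, `F₁ = 0`, `R₂ = φ`
  have hF0 : ∀ u : LoopSeq d, F 0 u = 0 := by
    intro u
    have h : Tendsto (fun N : ℕ => R 0 (box d (N * N)) N u) atTop (𝓝 0) := by
      simp only [hR0]; exact hsmall 2 (by norm_num) _ u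
    exact tendsto_nhds_unique (hF 0 u ⟨0, h⟩) h
  have hR1 : ∀ (Λ : Finset (Site d)) (N : ℕ) (u : LoopSeq d), R 1 Λ N u = phi N β Λ u / ((max N 1 : ℕ) : ℝ) := by
    intro Λ N u
    have h1 : ((max N 1 : ℕ) : ℝ) ≠ 0 := by linarith [hhat N]
    rw [hrec 0, hR0, hF0, sub_zero]
    field_simp
  have hF1 : ∀ u : LoopSeq d, F 1 u = 0 := by
    intro u
    have h : Tendsto (fun N : ℕ => R 1 (box d (N * N)) N u) atTop (𝓝 0) := by
      simp only [hR1]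
      have := hsmall 1 le_rfl (fun N => box d (N * N)) u
      simpa only [pow_one] using this
    exact tendsto_nhds_unique (hF 1 u ⟨0, h⟩) h
  have hR2 : ∀ (Λ : Finset (Site d)) (N : ℕ) (u : LoopSeq d), R 2 Λ N u = phi N β Λ u := by
    intro Λ N u
    have h1 : ((max N 1 : ℕ) : ℝ) ≠ 0 := by linarith [hhat N]
    rw [hrec 1, hR1, hF1, sub_zero]
    field_simp
  -- the weight is at least one
  have hΦ1 : ∀ t : LoopSeq d, (1 : ℝ) ≤ B * (K ^ t.index * catProd t) := fun t =>
    one_le_mul_of_one_le_of_one_le hB1 (one_le_mul_of_one_le_of_one_le (one_le_pow₀ hK1) (one_le_catProd t))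
  refine ⟨hR2, hF0, hF1, ?_, ?_, ?_, ?_, ?_, ?_⟩
  · intro Λ N _ t _
    rw [hR2]
    exact (abs_phi_le_one _ _ _ _).trans (hΦ1 t)
  · intro Λ N hN t _
    rw [hR1, hhat' N hN, abs_div, abs_of_pos (by positivity : (0 : ℝ) < N)]
    have hN1 : (1 : ℝ) ≤ N := by exact_mod_cast (by omega : 1 ≤ N)
    calc |phi N β Λ t| / N ≤ 1 / 1 := div_le_div₀ zero_le_one (abs_phi_le_one _ _ _ _) one_pos hN1
      _ ≤ B * (K ^ t.index * catProd t) := by rw [div_one]; exact hΦ1 t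
  · intro Λ hΛ N hN t ht hne hV
    simp only [hR2, hR1, hR0, hhat' N hN]
    exact base_equation hd hΛ hN β ht hne hV
  · intro M t
    simp only [hR1, hF1]
    simpa only [pow_one] using hsmall 1 le_rfl (fun N => box d (M N)) t
  · intro M t
    simp only [hR0, hF0]
    exact hsmall 2 (by norm_num) (fun N => box d (M N)) t
  · intro Λ N
    rw [hR2, phi_nil]

/-! ## From level `ℓ = j + 2` to its limit `F_ℓ` -/

/-- **The limit of one level and its characterisation** (`order_limit` instantiated on the hierarchy at level `j + 2` with the
depth `c_j(N) = 4j(log₂N + 3)` and the canonical cubes `[−N², N²]^d`).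
[cite: ChatterjeeJafarov2016OneOverN, Theorem 5.1 (recursion (5.2)), Theorem 5.6, Theorem 6.1] -/
theorem hierarchy_out {β : ℝ} {K B : ℕ → ℝ} (j : ℕ) (hK4 : 4 ≤ K j) (hB : 0 ≤ B j)
    (hθ : 2 / K j + |β| * (2 * ((2 * (d - 1) : ℕ) : ℝ) * 256 * K j ^ 4) ≤ 3 / 4)
    (hU : ∀ (G ψ ψ' : LoopSeq d → ℝ), ψ [] = ψ' [] →
      (∀ s : LoopSeq d, IsLoopSeq s → |ψ s| ≤ B j * (4 * K j) ^ s.len) →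
      (∀ s : LoopSeq d, IsLoopSeq s → |ψ' s| ≤ B j * (4 * K j) ^ s.len) →
      (∀ s : LoopSeq d, IsLoopSeq s → s ≠ [] →
          (s.len : ℝ) * ψ s -
            ((∑ o : InvIdx s, ψ (s.negSplitAt o)) - (∑ o : SameIdx s, ψ (s.posSplitAt o))
              + β * (∑ o : DeformIdx s, ψ (s.negDeformAt o)) - β * (∑ o : DeformIdx s, ψ (s.posDeformAt o))) = G s) →
      (∀ s : LoopSeq d, IsLoopSeq s → s ≠ [] →
          (s.len : ℝ) * ψ' s -
            ((∑ o : InvIdx s, ψ' (s.negSplitAt o)) - (∑ o : SameIdx s, ψ' (s.posSplitAt o))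
              + β * (∑ o : DeformIdx s, ψ' (s.negDeformAt o)) - β * (∑ o : DeformIdx s, ψ' (s.posDeformAt o))) = G s) →
      ∀ s : LoopSeq d, IsLoopSeq s → ψ s = ψ' s)
    (R : ℕ → Finset (Site d) → ℕ → LoopSeq d → ℝ) (F : ℕ → LoopSeq d → ℝ)
    (hF : ∀ (ℓ : ℕ) (t : LoopSeq d), (∃ q : ℝ, Tendsto (fun N : ℕ => R ℓ (box d (N * N)) N t) atTop (𝓝 q)) →
      Tendsto (fun N : ℕ => R ℓ (box d (N * N)) N t) atTop (𝓝 (F ℓ t)))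
    (a : ℝ) (hnil : ∀ (Λ : Finset (Site d)) (N : ℕ), R (j + 2) Λ N [] = a)
    (hAP : ∀ (Λ : Finset (Site d)) (N : ℕ), 2 ≤ N → ∀ t : LoopSeq d, IsLoopSeq t →
      (∀ l ∈ t, ∀ e ∈ l, ∀ v : Site d,
        latticeNorm (v - DEdge.src e) ≤ ((j * (4 * (Nat.log 2 N + 3)) : ℕ) : ℝ) ∨
          latticeNorm (v - DEdge.tgt e) ≤ ((j * (4 * (Nat.log 2 N + 3)) : ℕ) : ℝ) → v ∈ Λ) →
      |R (j + 2) Λ N t| ≤ B j * (K j ^ t.index * catProd t))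
    (hEQ : ∀ Λ : Finset (Site d), Λ.Nonempty → ∀ N : ℕ, 2 ≤ N → ∀ t : LoopSeq d, IsLoopSeq t → t ≠ [] →
      (∀ l ∈ t, ∀ e ∈ l, ∀ v : Site d,
        latticeNorm (v - DEdge.src e) ≤ 1 ∨ latticeNorm (v - DEdge.tgt e) ≤ 1 → v ∈ Λ) →
      (t.len : ℝ) * R (j + 2) Λ N t -
          ((∑ o : InvIdx t, R (j + 2) Λ N (t.negSplitAt o)) - (∑ o : SameIdx t, R (j + 2) Λ N (t.posSplitAt o))
            + β * (∑ o : DeformIdx t, R (j + 2) Λ N (t.negDeformAt o))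
            - β * (∑ o : DeformIdx t, R (j + 2) Λ N (t.posDeformAt o))) =
        (t.len : ℝ) * R (j + 1) Λ N t
          + ((∑ o : SameIdx t, R (j + 1) Λ N (t.negTwistAt o)) - ∑ o : InvIdx t, R (j + 1) Λ N (t.posTwistAt o))
          + ((∑ o : MergeIdx t, R j Λ N (t.negMergeAt o)) - ∑ o : MergeIdx t, R j Λ N (t.posMergeAt o)))
    (hC1 : ∀ M : ℕ → ℕ, (∀ b : ℕ, ∀ᶠ N : ℕ in atTop, j * (4 * (Nat.log 2 N + 3)) + b ≤ M N) → ∀ t : LoopSeq d, IsLoopSeq t →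
      Tendsto (fun N : ℕ => R (j + 1) (box d (M N)) N t) atTop (𝓝 (F (j + 1) t)))
    (hC0 : ∀ M : ℕ → ℕ, (∀ b : ℕ, ∀ᶠ N : ℕ in atTop, j * (4 * (Nat.log 2 N + 3)) + b ≤ M N) → ∀ t : LoopSeq d, IsLoopSeq t →
      Tendsto (fun N : ℕ => R j (box d (M N)) N t) atTop (𝓝 (F j t))) :
    (∀ M : ℕ → ℕ, (∀ b : ℕ, ∀ᶠ N : ℕ in atTop, j * (4 * (Nat.log 2 N + 3)) + b ≤ M N) → ∀ t : LoopSeq d, IsLoopSeq t →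
        Tendsto (fun N : ℕ => R (j + 2) (box d (M N)) N t) atTop (𝓝 (F (j + 2) t))) ∧
      F (j + 2) [] = a ∧
      (∀ t : LoopSeq d, IsLoopSeq t → |F (j + 2) t| ≤ B j * (K j ^ t.index * catProd t)) ∧
      (∀ t : LoopSeq d, IsLoopSeq t → t ≠ [] →
        (t.len : ℝ) * F (j + 2) t -
            ((∑ o : InvIdx t, F (j + 2) (t.negSplitAt o)) - (∑ o : SameIdx t, F (j + 2) (t.posSplitAt o))
              + β * (∑ o : DeformIdx t, F (j + 2) (t.negDeformAt o)) - β * (∑ o : DeformIdx t, F (j + 2) (t.posDeformAt o))) =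
          (t.len : ℝ) * F (j + 1) t
            + ((∑ o : SameIdx t, F (j + 1) (t.negTwistAt o)) - ∑ o : InvIdx t, F (j + 1) (t.posTwistAt o))
            + ((∑ o : MergeIdx t, F j (t.negMergeAt o)) - ∑ o : MergeIdx t, F j (t.posMergeAt o))) :=
  order_limit hK4 hB hθ hU (fun N => j * (4 * (Nat.log 2 N + 3))) (fun N => N * N) (adm_canonical j)
    (R (j + 2)) (R (j + 1)) (R j) (F (j + 2)) (F (j + 1)) (F j) a hnil (hF (j + 2)) hAP hEQ hC1 hC0

/-! ## From level `ℓ` to level `ℓ + 1` -/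

/-- **The inductive step of the hierarchy**: the a priori bounds, the hierarchy equation and the value at `∅` of the next level.
[cite: ChatterjeeJafarov2016OneOverN, Lemma 5.4 (a priori bound, equation (5.7)); Chatterjee2019LargeN, Theorem 3.6] -/
theorem hierarchy_succ {β : ℝ} {K B : ℕ → ℝ} (j : ℕ) (hK4 : 4 ≤ K j) (hKs : 64 * K j ^ 2 ≤ K (j + 1))
    (hB : 0 ≤ B j) (hBs : 21 * B j ≤ B (j + 1))
    (hθ' : 2 / K (j + 1) + |β| * (2 * ((2 * (d - 1) : ℕ) : ℝ) * 256 * K (j + 1) ^ 4) ≤ 3 / 4)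
    (R : ℕ → Finset (Site d) → ℕ → LoopSeq d → ℝ) (F : ℕ → LoopSeq d → ℝ)
    (hrec : ∀ (ℓ : ℕ) (Λ : Finset (Site d)) (N : ℕ) (u : LoopSeq d),
      R (ℓ + 1) Λ N u = ((max N 1 : ℕ) : ℝ) * (R ℓ Λ N u - F ℓ u))
    (a : ℝ) (hnil : ∀ (Λ : Finset (Site d)) (N : ℕ), R (j + 2) Λ N [] = a) (hFnil : F (j + 2) [] = a)
    (hAPQ : ∀ (Λ : Finset (Site d)) (N : ℕ), 2 ≤ N → ∀ t : LoopSeq d, IsLoopSeq t →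
      (∀ l ∈ t, ∀ e ∈ l, ∀ v : Site d,
        latticeNorm (v - DEdge.src e) ≤ ((j * (4 * (Nat.log 2 N + 3)) : ℕ) : ℝ) ∨
          latticeNorm (v - DEdge.tgt e) ≤ ((j * (4 * (Nat.log 2 N + 3)) : ℕ) : ℝ) → v ∈ Λ) →
      |R (j + 2) Λ N t| ≤ B j * (K j ^ t.index * catProd t))
    (hAPP : ∀ (Λ : Finset (Site d)) (N : ℕ), 2 ≤ N → ∀ t : LoopSeq d, IsLoopSeq t →
      (∀ l ∈ t, ∀ e ∈ l, ∀ v : Site d,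
        latticeNorm (v - DEdge.src e) ≤ ((j * (4 * (Nat.log 2 N + 3)) : ℕ) : ℝ) ∨
          latticeNorm (v - DEdge.tgt e) ≤ ((j * (4 * (Nat.log 2 N + 3)) : ℕ) : ℝ) → v ∈ Λ) →
      |R (j + 1) Λ N t| ≤ B j * (K j ^ t.index * catProd t))
    (hFB : ∀ t : LoopSeq d, IsLoopSeq t → |F (j + 2) t| ≤ B j * (K j ^ t.index * catProd t))
    (hEQ : ∀ Λ : Finset (Site d), Λ.Nonempty → ∀ N : ℕ, 2 ≤ N → ∀ t : LoopSeq d, IsLoopSeq t → t ≠ [] →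
      (∀ l ∈ t, ∀ e ∈ l, ∀ v : Site d,
        latticeNorm (v - DEdge.src e) ≤ 1 ∨ latticeNorm (v - DEdge.tgt e) ≤ 1 → v ∈ Λ) →
      (t.len : ℝ) * R (j + 2) Λ N t -
          ((∑ o : InvIdx t, R (j + 2) Λ N (t.negSplitAt o)) - (∑ o : SameIdx t, R (j + 2) Λ N (t.posSplitAt o))
            + β * (∑ o : DeformIdx t, R (j + 2) Λ N (t.negDeformAt o))
            - β * (∑ o : DeformIdx t, R (j + 2) Λ N (t.posDeformAt o))) =
        (t.len : ℝ) * R (j + 1) Λ N t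
          + ((∑ o : SameIdx t, R (j + 1) Λ N (t.negTwistAt o)) - ∑ o : InvIdx t, R (j + 1) Λ N (t.posTwistAt o))
          + ((∑ o : MergeIdx t, R j Λ N (t.negMergeAt o)) - ∑ o : MergeIdx t, R j Λ N (t.posMergeAt o)))
    (hFEQ : ∀ t : LoopSeq d, IsLoopSeq t → t ≠ [] →
      (t.len : ℝ) * F (j + 2) t -
          ((∑ o : InvIdx t, F (j + 2) (t.negSplitAt o)) - (∑ o : SameIdx t, F (j + 2) (t.posSplitAt o))
            + β * (∑ o : DeformIdx t, F (j + 2) (t.negDeformAt o)) - β * (∑ o : DeformIdx t, F (j + 2) (t.posDeformAt o))) =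
        (t.len : ℝ) * F (j + 1) t
          + ((∑ o : SameIdx t, F (j + 1) (t.negTwistAt o)) - ∑ o : InvIdx t, F (j + 1) (t.posTwistAt o))
          + ((∑ o : MergeIdx t, F j (t.negMergeAt o)) - ∑ o : MergeIdx t, F j (t.posMergeAt o))) :
    (∀ (Λ : Finset (Site d)) (N : ℕ), 2 ≤ N → ∀ t : LoopSeq d, IsLoopSeq t →
      (∀ l ∈ t, ∀ e ∈ l, ∀ v : Site d,
        latticeNorm (v - DEdge.src e) ≤ (((j + 1) * (4 * (Nat.log 2 N + 3)) : ℕ) : ℝ) ∨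
          latticeNorm (v - DEdge.tgt e) ≤ (((j + 1) * (4 * (Nat.log 2 N + 3)) : ℕ) : ℝ) → v ∈ Λ) →
      |R (j + 3) Λ N t| ≤ B (j + 1) * (K (j + 1) ^ t.index * catProd t)) ∧
    (∀ (Λ : Finset (Site d)) (N : ℕ), 2 ≤ N → ∀ t : LoopSeq d, IsLoopSeq t →
      (∀ l ∈ t, ∀ e ∈ l, ∀ v : Site d,
        latticeNorm (v - DEdge.src e) ≤ (((j + 1) * (4 * (Nat.log 2 N + 3)) : ℕ) : ℝ) ∨
          latticeNorm (v - DEdge.tgt e) ≤ (((j + 1) * (4 * (Nat.log 2 N + 3)) : ℕ) : ℝ) → v ∈ Λ) →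
      |R (j + 2) Λ N t| ≤ B (j + 1) * (K (j + 1) ^ t.index * catProd t)) ∧
    (∀ Λ : Finset (Site d), Λ.Nonempty → ∀ N : ℕ, 2 ≤ N → ∀ t : LoopSeq d, IsLoopSeq t → t ≠ [] →
      (∀ l ∈ t, ∀ e ∈ l, ∀ v : Site d,
        latticeNorm (v - DEdge.src e) ≤ 1 ∨ latticeNorm (v - DEdge.tgt e) ≤ 1 → v ∈ Λ) →
      (t.len : ℝ) * R (j + 3) Λ N t -
          ((∑ o : InvIdx t, R (j + 3) Λ N (t.negSplitAt o)) - (∑ o : SameIdx t, R (j + 3) Λ N (t.posSplitAt o))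
            + β * (∑ o : DeformIdx t, R (j + 3) Λ N (t.negDeformAt o))
            - β * (∑ o : DeformIdx t, R (j + 3) Λ N (t.posDeformAt o))) =
        (t.len : ℝ) * R (j + 2) Λ N t
          + ((∑ o : SameIdx t, R (j + 2) Λ N (t.negTwistAt o)) - ∑ o : InvIdx t, R (j + 2) Λ N (t.posTwistAt o))
          + ((∑ o : MergeIdx t, R (j + 1) Λ N (t.negMergeAt o)) - ∑ o : MergeIdx t, R (j + 1) Λ N (t.posMergeAt o))) ∧
    (∀ (Λ : Finset (Site d)) (N : ℕ), R (j + 3) Λ N [] = 0) := by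
  have hK1 : 1 ≤ K j := by linarith
  have hK0 : 0 ≤ K j := by linarith
  have hKK' : K j ≤ K (j + 1) := by nlinarith
  have hB' : B j ≤ B (j + 1) := by linarith
  have hhat' : ∀ N : ℕ, 2 ≤ N → ((max N 1 : ℕ) : ℝ) = N := fun N hN => by rw [max_eq_left (by omega)]
  -- the recursion at `N ≥ 2`
  have hrecQ : ∀ (Λ : Finset (Site d)) (N : ℕ), 2 ≤ N → ∀ u : LoopSeq d,
      R (j + 2) Λ N u = (N : ℝ) * (R (j + 1) Λ N u - F (j + 1) u) := fun Λ N hN u => by rw [hrec (j + 1), hhat' N hN]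
  have hrecP : ∀ (Λ : Finset (Site d)) (N : ℕ), 2 ≤ N → ∀ u : LoopSeq d,
      R (j + 1) Λ N u = (N : ℝ) * (R j Λ N u - F j u) := fun Λ N hN u => by rw [hrec j, hhat' N hN]
  have hrecN : ∀ (Λ : Finset (Site d)) (N : ℕ), 2 ≤ N → ∀ u : LoopSeq d,
      R (j + 3) Λ N u = (N : ℝ) * (R (j + 2) Λ N u - F (j + 2) u) := fun Λ N hN u => by rw [hrec (j + 2), hhat' N hN]
  -- radius monotonicity `c_j(N) ≤ c_{j+1}(N)`
  have hrad : ∀ N : ℕ, ((j * (4 * (Nat.log 2 N + 3)) : ℕ) : ℝ) ≤ (((j + 1) * (4 * (Nat.log 2 N + 3)) : ℕ) : ℝ) := by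
    intro N; exact_mod_cast Nat.mul_le_mul_right _ (Nat.le_succ j)
  refine ⟨?_, ?_, ?_, ?_⟩
  · -- a priori bound at level `j + 3`
    intro Λ N hN t ht hball
    have hsrc : ∀ u : LoopSeq d, IsLoopSeq u → u ≠ [] →
        (∀ l ∈ u, ∀ e ∈ l, ∀ v : Site d,
          latticeNorm (v - DEdge.src e) ≤ 1 ∨ latticeNorm (v - DEdge.tgt e) ≤ 1 → v ∈ Λ) →
        (u.len : ℝ) * (R (j + 2) Λ N u - F (j + 2) u) -
            ((∑ o : InvIdx u, (R (j + 2) Λ N (u.negSplitAt o) - F (j + 2) (u.negSplitAt o)))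
              - (∑ o : SameIdx u, (R (j + 2) Λ N (u.posSplitAt o) - F (j + 2) (u.posSplitAt o)))
              + β * (∑ o : DeformIdx u, (R (j + 2) Λ N (u.negDeformAt o) - F (j + 2) (u.negDeformAt o)))
              - β * (∑ o : DeformIdx u, (R (j + 2) Λ N (u.posDeformAt o) - F (j + 2) (u.posDeformAt o)))) =
          (1 / (N : ℝ)) * ((u.len : ℝ) * R (j + 2) Λ N u
            + ((∑ o : SameIdx u, R (j + 2) Λ N (u.negTwistAt o)) - ∑ o : InvIdx u, R (j + 2) Λ N (u.posTwistAt o))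
            + ((∑ o : MergeIdx u, R (j + 1) Λ N (u.negMergeAt o)) - ∑ o : MergeIdx u, R (j + 1) Λ N (u.posMergeAt o))) := by
      intro u hu hune hV
      have hΛ : Λ.Nonempty := by
        obtain ⟨l, hl⟩ := List.exists_mem_of_ne_nil u hune
        obtain ⟨e, he⟩ := List.exists_mem_of_ne_nil l (hu l hl).2
        exact ⟨DEdge.src e, hV l hl e he _ (Or.inl (by rw [sub_self, SOMasterLoop.latticeNorm_zero]; norm_num))⟩
      exact source_identity (by exact_mod_cast (by omega : N ≠ 0)) (R (j + 2) Λ N) (R (j + 1) Λ N) (R j Λ N)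
        (F (j + 2)) (F (j + 1)) (F j) (hrecQ Λ N hN) (hrecP Λ N hN) (hEQ Λ hΛ N hN u hu hune hV) (hFEQ u hu hune)
    have h := apriori_step (β := β) hK4 hKs hB hθ' (Λ := Λ) (by omega : 1 ≤ N) (depth_ok (by omega : 1 ≤ N))
      (j * (4 * (Nat.log 2 N + 3))) (R (j + 2) Λ N) (R (j + 1) Λ N) (F (j + 2)) (by rw [hnil, hFnil])
      (hAPQ Λ N hN) (hAPP Λ N hN) hFB hsrc t ht (by simpa only [Nat.succ_mul] using hball)
    rw [hrecN Λ N hN t]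
    exact h.trans (mul_le_mul_of_nonneg_right hBs (mul_nonneg (pow_nonneg (by nlinarith) _) (catProd_nonneg _)))
  · -- a priori bound at level `j + 2`, larger radius and constants
    intro Λ N hN t ht hball
    exact (hAPQ Λ N hN t ht (ball_mono (hrad N) hball)).trans
      (mul_le_mul hB' (weight_mono hK0 hKK' t) (mul_nonneg (pow_nonneg hK0 _) (catProd_nonneg _)) (hB.trans hB'))
  · -- the hierarchy equation at level `j + 3`
    intro Λ hΛ N hN t ht hne hV
    exact equation_next (R (j + 3) Λ N) (R (j + 2) Λ N) (R (j + 1) Λ N) (R j Λ N) (F (j + 2)) (F (j + 1)) (F j)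
      (hrecN Λ N hN) (hrecQ Λ N hN) (hrecP Λ N hN) (hEQ Λ hΛ N hN t ht hne hV) (hFEQ t ht hne)
  · -- value at `∅`
    intro Λ N
    rw [hrec (j + 2), hnil, hFnil, sub_self, mul_zero]

end StringDuality

end Summit.QuantumFields.GaugeBoot

end
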